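import Mathlib
import Summits.MatrixMultiplication.Statement
import Summits.MatrixMultiplication.MatrixMultiplication.Theorems.GraphEquationsAffineJets

/-!
# Graph equations — affine recentring substitutions (M25c)

Generic bookkeeping for the substitution `θ₁` of the S1 binder (NODE-g36 §3, file S4).  A
RECENTRING is a substitution of the shape `θ v = ι(L v) + X v` with `L v` an AFFINE polynomial in
base variables `σ₀` embedded by an injection `ι = rename ii`:

* `affTrunc f` — the affine truncation `f(0) + ∑_u (∂_u f)(0) X_u` and its coefficients;
* `recentre ii L` — cost-free when the `L v` are (`recentre_mem_freeSpan`), constant terms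
  `constantCoeff (L v)`, and for a variable `y` outside the range of `ii` the coefficient of `X y`
  in `θ v` is `[v = y]`, so the first-order Taylor formula collapses:
  `coeff_{X y} (g ∘ θ) = (∂_y g)(L(0))` (`coeff_single_bind₁_recentre`);
* `bind₁_bind₁_recentre` — composing with a substitution `Φ` fixing the base variables gives
  `Φ (g ∘ θ) = g (L + Φ)`.
-/

set_option linter.dupNamespace false

noncomputable section

open scoped BigOperators

namespace Summit.MatrixMultiplication.MatrixMultiplication.Theorems.GraphEquations

open MvPolynomial
open Literature.Computability.AlgebraicComplexity

section AffTrunc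

variable {σ₀ : Type} [Fintype σ₀] [DecidableEq σ₀]

/-- The affine truncation `f(0) + ∑_u coeff_{X u}(f) · X u`. -/
def affTrunc (f : MvPolynomial σ₀ ℂ) : MvPolynomial σ₀ ℂ :=
  C (coeff 0 f) + ∑ u, coeff (Finsupp.single u 1) f • X u

/-- Coefficients of a variable (stable form). -/
theorem coeff_X_eq {σ : Type} [DecidableEq σ] (m : σ →₀ ℕ) (i : σ) :
    coeff m (X i : MvPolynomial σ ℂ) = if Finsupp.single i 1 = m then 1 else 0 := by
  show coeff m (monomial (Finsupp.single i 1) 1) = _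
  rw [coeff_monomial]

omit [DecidableEq σ₀] in
/-- The affine truncation is cost-free. -/
theorem affTrunc_mem_freeSpan (f : MvPolynomial σ₀ ℂ) : affTrunc f ∈ freeSpan ∅ :=
  Submodule.add_mem _ (C_mem_freeSpan _ _)
    (Submodule.sum_mem _ fun u _ => Submodule.smul_mem _ _ (X_mem_freeSpan _ u))

/-- Constant term of the affine truncation. -/
theorem coeff_zero_affTrunc (f : MvPolynomial σ₀ ℂ) : coeff 0 (affTrunc f) = coeff 0 f := by
  rw [affTrunc, coeff_add, coeff_C, if_pos rfl, coeff_sum, Finset.sum_eq_zero, add_zero]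
  intro u _
  rw [coeff_smul, coeff_X_eq, if_neg (Finsupp.single_ne_zero.mpr one_ne_zero), smul_zero]

/-- Linear coefficients of the affine truncation. -/
theorem coeff_single_affTrunc (f : MvPolynomial σ₀ ℂ) (w : σ₀) :
    coeff (Finsupp.single w 1) (affTrunc f) = coeff (Finsupp.single w 1) f := by
  rw [affTrunc, coeff_add, coeff_C, if_neg (Finsupp.single_ne_zero.mpr one_ne_zero).symm, zero_add,
    coeff_sum]
  simp_rw [coeff_smul, coeff_X_eq, Finsupp.single_left_inj one_ne_zero, smul_eq_mul, mul_ite, mul_one,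
    mul_zero]
  rw [Finset.sum_ite_eq' Finset.univ w, if_pos (Finset.mem_univ w)]

/-- `f - affTrunc f` has no constant term. -/
theorem coeff_zero_sub_affTrunc (f : MvPolynomial σ₀ ℂ) : coeff 0 (f - affTrunc f) = 0 := by
  rw [coeff_sub, coeff_zero_affTrunc, sub_self]

/-- `f - affTrunc f` has no linear terms. -/
theorem coeff_single_sub_affTrunc (f : MvPolynomial σ₀ ℂ) (w : σ₀) :
    coeff (Finsupp.single w 1) (f - affTrunc f) = 0 := by
  rw [coeff_sub, coeff_single_affTrunc, sub_self]

/-- Constant coefficient of the affine truncation. -/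
theorem constantCoeff_affTrunc (f : MvPolynomial σ₀ ℂ) :
    constantCoeff (affTrunc f) = constantCoeff f :=
  coeff_zero_affTrunc f

end AffTrunc

section Recentre

variable {σ₀ V : Type}

/-- The recentring substitution `v ↦ ι(L v) + X v`, `ι = rename ii`. -/
def recentre (ii : σ₀ → V) (L : V → MvPolynomial σ₀ ℂ) : V → MvPolynomial V ℂ :=
  fun v => rename ii (L v) + X v

/-- `recentre` unfolds. -/
theorem recentre_apply (ii : σ₀ → V) (L : V → MvPolynomial σ₀ ℂ) (v : V) :
    recentre ii L v = rename ii (L v) + X v := rfl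

/-- A recentring with affine (cost-free) `L` is cost-free. -/
theorem recentre_mem_freeSpan (ii : σ₀ → V) {L : V → MvPolynomial σ₀ ℂ}
    (hL : ∀ v, L v ∈ freeSpan ∅) (v : V) : recentre ii L v ∈ freeSpan ∅ :=
  Submodule.add_mem _ (rename_mem_freeSpan_empty _ (hL v)) (X_mem_freeSpan _ v)

/-- Constant terms of a recentring. -/
theorem constantCoeff_recentre (ii : σ₀ → V) (L : V → MvPolynomial σ₀ ℂ) (v : V) :
    constantCoeff (recentre ii L v) = constantCoeff (L v) := by
  rw [recentre_apply, map_add, constantCoeff_rename, constantCoeff_X, add_zero]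

/-- A renamed polynomial has no `X y` coefficient for `y` outside the range of the renaming. -/
theorem coeff_single_rename_eq_zero (ii : σ₀ → V) {y : V} (hy : y ∉ Set.range ii)
    (f : MvPolynomial σ₀ ℂ) : coeff (Finsupp.single y 1) (rename ii f) = 0 := by
  classical
  refine coeff_rename_eq_zero _ _ _ fun u hu => ?_
  have hmem : y ∈ (Finsupp.mapDomain ii u).support := by
    rw [hu, Finsupp.mem_support_iff, Finsupp.single_eq_same]; exact one_ne_zero
  obtain ⟨x, -, hx⟩ := Finset.mem_image.mp (Finsupp.mapDomain_support hmem)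
  exact (hy ⟨x, hx⟩).elim

/-- Linear coefficients of a recentring at a variable outside the base range. -/
theorem coeff_single_recentre [DecidableEq V] (ii : σ₀ → V) (L : V → MvPolynomial σ₀ ℂ) {y : V}
    (hy : y ∉ Set.range ii) (v : V) :
    coeff (Finsupp.single y 1) (recentre ii L v) = if v = y then 1 else 0 := by
  rw [recentre_apply, coeff_add, coeff_single_rename_eq_zero ii hy, zero_add, coeff_X_eq]
  by_cases h : v = y
  · subst h; simp
  · rw [if_neg h, if_neg (mt (Finsupp.single_left_inj one_ne_zero).mp h)]

/-- **Collapsed Taylor formula**: for `y` outside the base range, the coefficient of `X y` in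
`g ∘ recentre` is `(∂_y g)` at the constants `L(0)`. -/
theorem coeff_single_bind₁_recentre [Fintype V] [DecidableEq V] (ii : σ₀ → V)
    (L : V → MvPolynomial σ₀ ℂ) {y : V} (hy : y ∉ Set.range ii) (g : MvPolynomial V ℂ) :
    coeff (Finsupp.single y 1) (bind₁ (recentre ii L) g) =
      aeval (fun v => constantCoeff (L v)) (pderiv y g) := by
  rw [coeff_single_bind₁_taylor]
  simp_rw [coeff_single_recentre ii L hy, mul_ite, mul_one, mul_zero, constantCoeff_recentre]
  rw [Finset.sum_ite_eq' Finset.univ y, if_pos (Finset.mem_univ y)]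

/-- Constant term of `g ∘ recentre`: `g (L(0))`. -/
theorem constantCoeff_bind₁_recentre (ii : σ₀ → V) (L : V → MvPolynomial σ₀ ℂ) (g : MvPolynomial V ℂ) :
    constantCoeff (bind₁ (recentre ii L) g) = aeval (fun v => constantCoeff (L v)) g := by
  rw [constantCoeff_bind₁]
  simp_rw [constantCoeff_recentre]

/-- A substitution fixing the base variables undoes the embedding `rename ii`. -/
theorem bind₁_rename_of_base (ii : σ₀ → V) {Φ : V → MvPolynomial σ₀ ℂ} (hΦ : ∀ u, Φ (ii u) = X u)
    (f : MvPolynomial σ₀ ℂ) : bind₁ Φ (rename ii f) = f := by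
  rw [bind₁_rename]
  have : (Φ ∘ ii) = X := funext hΦ
  rw [this]
  exact congrFun (congrArg DFunLike.coe (bind₁_X_left (σ := σ₀) (R := ℂ))) f

/-- Composing a recentring with a substitution fixing the base variables. -/
theorem bind₁_recentre (ii : σ₀ → V) (L : V → MvPolynomial σ₀ ℂ) {Φ : V → MvPolynomial σ₀ ℂ}
    (hΦ : ∀ u, Φ (ii u) = X u) (v : V) : bind₁ Φ (recentre ii L v) = L v + Φ v := by
  rw [recentre_apply, map_add, bind₁_rename_of_base ii hΦ, bind₁_X_right]

/-- **`Φ (g ∘ θ) = g (L + Φ)`** for a recentring `θ` and a base-fixing substitution `Φ`. -/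
theorem bind₁_bind₁_recentre (ii : σ₀ → V) (L : V → MvPolynomial σ₀ ℂ) {Φ : V → MvPolynomial σ₀ ℂ}
    (hΦ : ∀ u, Φ (ii u) = X u) (g : MvPolynomial V ℂ) :
    bind₁ Φ (bind₁ (recentre ii L) g) = aeval (fun v => L v + Φ v) g := by
  rw [bind₁_bind₁]
  have : (fun v => bind₁ Φ (recentre ii L v)) = fun v => L v + Φ v := funext (bind₁_recentre ii L hΦ)
  rw [this]
  rfl

end Recentre

end Summit.MatrixMultiplication.MatrixMultiplication.Theorems.GraphEquations

end
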